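import Summits.CriticalPhenomena.CardyFormulaZ2.Theorems.CardyIKTransportCornerLineDescentCrudeContinuity2

/-!
# The frozen end's continuity statement from Schramm–Smirnov (5.1), II: the lower inclusion

Support file (part 2 of 3 of the bridge `SchrammSmirnov2011_lemma_5_1 → ∀ R, Freeze.CrudeCrossingContinuity R`) for
the registered stub `stub_CrudeCrossingContinuity` of the line `symmetric-seed-second-order` of the crux
`CardyIKTransport.CornerLineDescent` (stmt-CriticalPhenomena-10964), over part 1 (`…CrudeContinuity2.lean`: the
transposed square model `Freeze.tmodel`, the chart quads, the upper inclusion).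

The lower inclusion `Freeze.exists_lower_data` (anchor `thinQuad_crossing_subset_lowerCrossing`): given
`0 < s ≤ 1/2` and `η > 0` there are `0 < t ≤ η`, a collar scale `κ > 0` and `r > 0` such that for meshes `δ` and
thinning radii `ρ` with `δ√2 + ρ ≤ r`, every Schramm–Smirnov crossing inside the drawn open edges of the long thin
chart quad `Freeze.thinQuad Ψ t s = Ψ([-1-t,1+t] × [-1+s,1-s])` (it sticks out of the domain across the arcs `0`, `2`
and keeps off the arcs `1`, `3`) yields the thinned collar-to-collar crude event `Freeze.lowerCrossing R κ ρ δ` of the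
vocabulary: the open edges drawn through the crossing are chained into an open lattice path
(`openConnIn_of_isPreconnected_subset_openEdgeUnion`) whose vertices have their `ρ`-balls in the enlarged domain
`Ω ∪ collar₀ ∪ collar₂`, from a vertex whose ball lies in `collar₀ ∖ Ω` to one whose ball lies in `collar₂ ∖ Ω`.  The
geometry: `κ` is a quarter of the smaller of the two gaps (middle band `Ψ([-1,1] × [-1+s,1-s])` to the arcs `1 ∪ 3`)
and (arc `0` to arc `2`); `t` is small enough for `Ψ` to move the outer sides by at most `κ/4` (uniform continuity on
`[-2,2]²`); `r ≤ κ/8` is below the gaps of the two outer sides to the closed domain; a point `ρ + δ√2`-close to the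
quad is in `Ω`, or reaches the frontier along a short segment through the arc `0` or `2` and then lies in the
corresponding collar (`Freeze.mem_sideCollar_of`).  Everything here is proved; no named fact is introduced.
References: Schramm–Smirnov, Ann. Probab. 39 (2011) §1.3 ("no difference between connected and path-connected
crossings"), §5; route file `Theses/CardyIKTransport.lean` (item 10964).
-/

noncomputable section

namespace Summit.CriticalPhenomena.CardyFormulaZ2.Theorems.CornerLineDescent.SymmetricSeed

open scoped Topology unitInterval ENNReal
open Filter Set Function Metric MeasureTheory
open Literature.Probability.Percolation (IsSquareModel exists_isSquareModel unitSquareQuad unitSquareQuad_carrier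
  BondConfig openEdgeUnion mem_openEdgeUnion_iff openCrossing openConnIn bondPercolation half)
open Literature.Probability.Percolation.QuadCrossing (Quad)
open Literature.Probability.Percolation.QuadCrossing.Quad (rectChart rectChart_re_im continuous_rectChart
  rectChart_injective carrier_eq_of_chart side_zero_eq_of_chart side_two_eq_of_chart Dominated StrictlyDominated
  strictlyDominated_iff)
open Literature.Probability.LatticeModels
open Literature.Probability.RandomPlanarGeometry

namespace Freeze

/-! ## The long thin chart quad's crossings are collar-to-collar crude crossings -/

/-- COLLAR CRITERION: a point within `< κ` of `arc i` and at distance `≥ 3κ` from the three other arcs lies in the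
collar of side `i` at scale `κ`. [folklore] -/
theorem mem_sideCollar_of {R : ConformalRectangle} {i : Fin 4} {κ : ℝ} {z : ℂ}
    (hnear : ∃ v ∈ R.arc i, dist z v < κ) (hfar : ∀ j, j ≠ i → ∀ l ∈ R.arc j, 3 * κ ≤ dist z l) :
    z ∈ sideCollar R i κ := by
  obtain ⟨v, hv, hzv⟩ := hnear
  have hκ : 0 < κ := dist_nonneg.trans_lt hzv
  refine ⟨(infDist_le_dist_of_mem hv).trans_lt hzv, ?_⟩
  obtain ⟨j, hj⟩ : ∃ j : Fin 4, j ≠ i := by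
    by_cases hi : i = 0
    · exact ⟨1, by rw [hi]; decide⟩
    · exact ⟨0, fun h => hi h.symm⟩
  have hne : (otherArcs R i).Nonempty := ⟨_, arc_subset_otherArcs hj (R.pt_mem_arc_self j)⟩
  have h3 : 3 * κ ≤ infDist z (otherArcs R i) := (le_infDist hne).2 fun l hl => by
    obtain ⟨j, hj, hl⟩ := mem_iUnion₂.1 hl
    exact hfar j hj l hl
  linarith

section Lower

variable {R : ConformalRectangle} {Φ : ℂ ≃ₜ ℂ} (hΦ : IsSquareModel R Φ)
include hΦ

/-- THE LOWER INCLUSION.  For `0 < s ≤ 1/2` and `η > 0` there are `0 < t ≤ η`, a collar scale `κ > 0` and `r > 0`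
such that for meshes `δ` and radii `ρ` with `δ√2 + ρ ≤ r`, every crossing inside the drawn open edges of the long
thin chart quad `Ψ([-1-t, 1+t] × [-1+s, 1-s])` (`Ψ` the transposed square model; the quad sticks out of the domain
across the arcs `0`, `2` and keeps off the arcs `1`, `3`) yields the thinned collar-to-collar crude event
`lowerCrossing R κ ρ δ`: the open edges drawn through the crossing are chained into an open lattice path
(`openConnIn_of_isPreconnected_subset_openEdgeUnion`), all of whose vertices have their `ρ`-balls in the enlarged
domain, from a vertex whose ball is in `collar₀ ∖ Ω` to one whose ball is in `collar₂ ∖ Ω`.  The scale `κ` is a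
quarter of the smaller of the gaps (middle band `Ψ([-1,1] × [-1+s,1-s])` to arcs `1 ∪ 3`) and (arc `0` to arc `2`);
`t` makes `Ψ` move the outer sides by `≤ κ/4`; `r ≤ κ/8` is below the gaps of the outer sides to the closed domain.
[folklore] -/
theorem exists_lower_data {s : ℝ} (hs : 0 < s) (hs1 : s ≤ 1 / 2) {η : ℝ} (hη : 0 < η) :
    ∃ t : ℝ, 0 < t ∧ t ≤ η ∧ ∃ κ : ℝ, 0 < κ ∧ ∃ r : ℝ, 0 < r ∧
      ∀ δ ρ : ℝ, 0 < δ → 0 ≤ ρ → δ * Real.sqrt 2 + ρ ≤ r →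
        ∀ (ω : BondConfig (Site 2)) (K : Set ℂ), (thinQuad (tmodel Φ) t s).IsCrossing K →
          K ⊆ openEdgeUnion (δ * Real.sqrt 2) ω → ω ∈ lowerCrossing R κ ρ δ := by
  set Ψ := tmodel Φ with hΨ
  -- the middle band, the side arcs `1 ∪ 3`, and the two gaps defining `κ`
  set Mid : Set ℂ := Ψ '' (Icc (-1 : ℝ) 1 ×ℂ Icc (-1 + s) (1 - s)) with hMid
  have hMidc : IsCompact Mid := (isCompact_Icc.reProdIm isCompact_Icc).image Ψ.continuous
  set A13 : Set ℂ := R.arc 1 ∪ R.arc 3 with hA13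
  have hA13c : IsClosed A13 := (R.isClosed_arc 1).union (R.isClosed_arc 3)
  have hdisj₁ : Disjoint Mid A13 := by
    rw [hA13, ← tmodel_image_top hΦ, ← tmodel_image_bot hΦ, ← image_union, Set.disjoint_image_iff Ψ.injective,
      Set.disjoint_left]
    intro z hz hz'
    rw [Complex.mem_reProdIm, mem_Icc] at hz
    rw [mem_union, Complex.mem_reProdIm, Complex.mem_reProdIm, mem_singleton_iff, mem_singleton_iff] at hz'
    rcases hz' with ⟨-, h1⟩ | ⟨-, h1⟩ <;> linarith [hz.2.1, hz.2.2]
  obtain ⟨M₁, hM₁, hM₁d⟩ := exists_gap hMidc hA13c hdisj₁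
  have hdisj₂ : Disjoint (R.arc 0) (R.arc 2) := by
    rw [← tmodel_image_left hΦ, ← tmodel_image_right hΦ, Set.disjoint_image_iff Ψ.injective, Set.disjoint_left]
    intro z h0 h2
    rw [Complex.mem_reProdIm, mem_singleton_iff] at h0 h2
    linarith [h0.1, h2.1]
  obtain ⟨M₂, hM₂, hM₂d⟩ := exists_gap (R.isCompact_arc 0) (R.isClosed_arc 2) hdisj₂
  set κ : ℝ := min M₁ M₂ / 4 with hκdef
  have hκ : 0 < κ := div_pos (lt_min hM₁ hM₂) four_pos
  have hκM₁ : 4 * κ ≤ M₁ := by rw [hκdef]; linarith [min_le_left M₁ M₂]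
  have hκM₂ : 4 * κ ≤ M₂ := by rw [hκdef]; linarith [min_le_right M₁ M₂]
  -- the modulus of `Ψ` for `κ/4`, and `t`
  obtain ⟨η', hη', hmod⟩ := exists_modulus Ψ (by positivity : 0 < κ / 4)
  set t : ℝ := min η (min η' (1 / 2)) with htdef
  have ht : 0 < t := lt_min hη (lt_min hη' one_half_pos)
  have htη : t ≤ η := min_le_left _ _
  have htη' : t ≤ η' := (min_le_right _ _).trans (min_le_left _ _)
  have ht1 : t ≤ 1 / 2 := (min_le_right _ _).trans (min_le_right _ _)
  -- the two outer sides and their gaps to the closed domain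
  have hcl : closure R.carrier = Ψ '' (Icc (-1 : ℝ) 1 ×ℂ Icc (-1 : ℝ) 1) := (tmodel_image_Icc hΦ).symm
  set L₀ : Set ℂ := Ψ '' ({(-1 - t : ℝ)} ×ℂ Icc (-1 + s) (1 - s)) with hL₀
  set L₂ : Set ℂ := Ψ '' ({(1 + t : ℝ)} ×ℂ Icc (-1 + s) (1 - s)) with hL₂
  have hL₀c : IsCompact L₀ := (isCompact_singleton.reProdIm isCompact_Icc).image Ψ.continuous
  have hL₂c : IsCompact L₂ := (isCompact_singleton.reProdIm isCompact_Icc).image Ψ.continuous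
  have hdisj₀ : Disjoint L₀ (closure R.carrier) := by
    rw [hcl, Set.disjoint_image_iff Ψ.injective, Set.disjoint_left]
    intro z h0 h1
    rw [Complex.mem_reProdIm, mem_singleton_iff] at h0
    rw [Complex.mem_reProdIm, mem_Icc] at h1
    linarith [h0.1, h1.1.1, h1.1.2]
  have hdisj₂' : Disjoint L₂ (closure R.carrier) := by
    rw [hcl, Set.disjoint_image_iff Ψ.injective, Set.disjoint_left]
    intro z h0 h1
    rw [Complex.mem_reProdIm, mem_singleton_iff] at h0
    rw [Complex.mem_reProdIm, mem_Icc] at h1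
    linarith [h0.1, h1.1.1, h1.1.2]
  obtain ⟨g₀, hg₀, hg₀d⟩ := exists_gap hL₀c isClosed_closure hdisj₀
  obtain ⟨g₂, hg₂, hg₂d⟩ := exists_gap hL₂c isClosed_closure hdisj₂'
  refine ⟨t, ht, htη, κ, hκ, min (κ / 4) (min g₀ g₂) / 2, by positivity, ?_⟩
  rw [thinQuad_eq _ ht hs (by linarith)]
  intro δ ρ hδ hρ hr ω K hK hKO
  set r : ℝ := min (κ / 4) (min g₀ g₂) / 2 with hrdef
  have hrκ : 8 * r ≤ κ := by rw [hrdef]; linarith [min_le_left (κ / 4) (min g₀ g₂)]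
  have hrg₀ : r < g₀ := by
    rw [hrdef]; linarith [(min_le_right (κ / 4) (min g₀ g₂)).trans (min_le_left g₀ g₂)]
  have hrg₂ : r < g₂ := by
    rw [hrdef]; linarith [(min_le_right (κ / 4) (min g₀ g₂)).trans (min_le_right g₀ g₂)]
  have hr0 : 0 ≤ r := by positivity
  set m := δ * Real.sqrt 2 with hm
  have hmpos : 0 < m := by positivity
  have hpt : ∀ x : Site 2, (δ : ℂ) * squareLatticeEmbedding.z x = meshPoint m x := smul_z_eq_meshPoint δ
  obtain ⟨hKc, hKconn, hKsub, ⟨k₀, hk₀K, hk₀⟩, ⟨k₁, hk₁K, hk₁⟩⟩ := hK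
  rw [carrier_chartQuad] at hKsub
  rw [side_zero_chartQuad] at hk₀
  rw [side_two_chartQuad] at hk₁
  -- square points are in `[-2, 2]²`
  have hsq : ∀ w : ℂ, w.re ∈ Icc (-1 - t) (1 + t) → w.im ∈ Icc (-1 + s) (1 - s) →
      w ∈ Icc (-2 : ℝ) 2 ×ℂ Icc (-2 : ℝ) 2 := fun w hre him => by
    rw [Complex.mem_reProdIm, mem_Icc, mem_Icc]
    rw [mem_Icc] at hre him
    exact ⟨⟨by linarith, by linarith⟩, by linarith, by linarith⟩
  -- far from the other arcs: from the two gaps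
  have hfar0 : ∀ v ∈ R.arc 0, v ∈ Mid → ∀ z : ℂ, dist z v ≤ κ → ∀ j, j ≠ (0 : Fin 4) → ∀ l ∈ R.arc j,
      3 * κ ≤ dist z l := by
    intro v hv0 hvM z hzv j hj l hl
    have key : min M₁ M₂ < dist v l := by
      fin_cases j
      · exact absurd rfl hj
      · exact (min_le_left _ _).trans_lt (hM₁d v hvM l (Or.inl hl))
      · exact (min_le_right _ _).trans_lt (hM₂d v hv0 l hl)
      · exact (min_le_left _ _).trans_lt (hM₁d v hvM l (Or.inr hl))
    have h4 : 4 * κ = min M₁ M₂ := by rw [hκdef]; ring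
    linarith [dist_triangle v z l, dist_comm v z]
  have hfar2 : ∀ v ∈ R.arc 2, v ∈ Mid → ∀ z : ℂ, dist z v ≤ κ → ∀ j, j ≠ (2 : Fin 4) → ∀ l ∈ R.arc j,
      3 * κ ≤ dist z l := by
    intro v hv2 hvM z hzv j hj l hl
    have key : min M₁ M₂ < dist v l := by
      fin_cases j
      · rw [dist_comm]; exact (min_le_right _ _).trans_lt (hM₂d l hl v hv2)
      · exact (min_le_left _ _).trans_lt (hM₁d v hvM l (Or.inl hl))
      · exact absurd rfl hj
      · exact (min_le_left _ _).trans_lt (hM₁d v hvM l (Or.inr hl))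
    have h4 : 4 * κ = min M₁ M₂ := by rw [hκdef]; ring
    linarith [dist_triangle v z l, dist_comm v z]
  -- collar membership near the left and right parts of the quad
  have collar0 : ∀ w : ℂ, w.re ∈ Icc (-1 - t) (-1) → w.im ∈ Icc (-1 + s) (1 - s) →
      ∀ z : ℂ, dist z (Ψ w) ≤ κ / 4 → z ∈ sideCollar R 0 κ := by
    intro w hwre hwim z hzw
    rw [mem_Icc] at hwre hwim
    set w' : ℂ := ⟨-1, w.im⟩ with hw'
    have hw'0 : Ψ w' ∈ R.arc 0 := by
      rw [← tmodel_image_left hΦ]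
      refine mem_image_of_mem _ ?_
      rw [Complex.mem_reProdIm, mem_singleton_iff, mem_Icc]
      exact ⟨rfl, by show -1 ≤ w.im; linarith, by show w.im ≤ 1; linarith⟩
    have hw'M : Ψ w' ∈ Mid := by
      refine mem_image_of_mem _ ?_
      rw [Complex.mem_reProdIm, mem_Icc, mem_Icc]
      exact ⟨⟨by show (-1 : ℝ) ≤ -1; norm_num, by show (-1 : ℝ) ≤ 1; norm_num⟩, hwim.1, hwim.2⟩
    have hww' : dist (Ψ w) (Ψ w') ≤ κ / 4 := by
      refine hmod w (hsq w ⟨hwre.1, by linarith⟩ ⟨hwim.1, hwim.2⟩) w'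
        (hsq w' ⟨by show -1 - t ≤ (-1 : ℝ); linarith, by show (-1 : ℝ) ≤ 1 + t; linarith⟩ ⟨hwim.1, hwim.2⟩) ?_
      rw [dist_eq_norm]
      refine (Complex.norm_le_abs_re_add_abs_im _).trans ?_
      rw [Complex.sub_re, Complex.sub_im]
      have : w.im - w'.im = 0 := by show w.im - w.im = 0; ring
      rw [this, abs_zero, add_zero, show w'.re = -1 from rfl, abs_le]
      constructor <;> linarith
    have hzw' : dist z (Ψ w') ≤ κ / 2 := by linarith [dist_triangle z (Ψ w) (Ψ w')]
    exact mem_sideCollar_of ⟨Ψ w', hw'0, by linarith⟩ (hfar0 _ hw'0 hw'M z (by linarith))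
  have collar2 : ∀ w : ℂ, w.re ∈ Icc 1 (1 + t) → w.im ∈ Icc (-1 + s) (1 - s) →
      ∀ z : ℂ, dist z (Ψ w) ≤ κ / 4 → z ∈ sideCollar R 2 κ := by
    intro w hwre hwim z hzw
    rw [mem_Icc] at hwre hwim
    set w' : ℂ := ⟨1, w.im⟩ with hw'
    have hw'2 : Ψ w' ∈ R.arc 2 := by
      rw [← tmodel_image_right hΦ]
      refine mem_image_of_mem _ ?_
      rw [Complex.mem_reProdIm, mem_singleton_iff, mem_Icc]
      exact ⟨rfl, by show -1 ≤ w.im; linarith, by show w.im ≤ 1; linarith⟩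
    have hw'M : Ψ w' ∈ Mid := by
      refine mem_image_of_mem _ ?_
      rw [Complex.mem_reProdIm, mem_Icc, mem_Icc]
      exact ⟨⟨by show (-1 : ℝ) ≤ 1; norm_num, by show (1 : ℝ) ≤ 1; norm_num⟩, hwim.1, hwim.2⟩
    have hww' : dist (Ψ w) (Ψ w') ≤ κ / 4 := by
      refine hmod w (hsq w ⟨by linarith, hwre.2⟩ ⟨hwim.1, hwim.2⟩) w'
        (hsq w' ⟨by show -1 - t ≤ (1 : ℝ); linarith, by show (1 : ℝ) ≤ 1 + t; linarith⟩ ⟨hwim.1, hwim.2⟩) ?_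
      rw [dist_eq_norm]
      refine (Complex.norm_le_abs_re_add_abs_im _).trans ?_
      rw [Complex.sub_re, Complex.sub_im]
      have : w.im - w'.im = 0 := by show w.im - w.im = 0; ring
      rw [this, abs_zero, add_zero, show w'.re = 1 from rfl, abs_le]
      constructor <;> linarith
    have hzw' : dist z (Ψ w') ≤ κ / 2 := by linarith [dist_triangle z (Ψ w) (Ψ w')]
    exact mem_sideCollar_of ⟨Ψ w', hw'2, by linarith⟩ (hfar2 _ hw'2 hw'M z (by linarith))
  -- points near the quad lie in the enlarged domain
  have henl : ∀ k ∈ Ψ '' (Icc (-1 - t) (1 + t) ×ℂ Icc (-1 + s) (1 - s)), ∀ z : ℂ, dist z k ≤ r →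
      z ∈ enlarge R κ := by
    intro k hk z hzk
    by_cases hzΩ : z ∈ R.carrier
    · exact Or.inl (Or.inl hzΩ)
    obtain ⟨w, hw, rfl⟩ := hk
    rw [Complex.mem_reProdIm, mem_Icc] at hw
    rcases le_or_gt w.re (-1) with hwl | hwl
    · exact Or.inl (Or.inr (collar0 w ⟨hw.1.1, hwl⟩ hw.2 z (by linarith)))
    rcases le_or_gt 1 w.re with hwr | hwr
    · exact Or.inr (collar2 w ⟨hwr, hw.1.2⟩ hw.2 z (by linarith))
    -- the interior case: the segment to `z` leaves the domain through `arc 0` or `arc 2`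
    have hwim := hw.2
    rw [mem_Icc] at hwim
    have hkΩ : Ψ w ∈ R.carrier := by
      rw [← tmodel_image_Ioo hΦ]
      refine mem_image_of_mem _ ?_
      rw [Complex.mem_reProdIm, mem_Ioo, mem_Ioo]
      exact ⟨⟨hwl, hwr⟩, by linarith, by linarith⟩
    have hkMid : Ψ w ∈ Mid := by
      refine mem_image_of_mem _ ?_
      rw [Complex.mem_reProdIm, mem_Icc]
      exact ⟨⟨hwl.le, hwr.le⟩, hw.2⟩
    obtain ⟨v, hvseg, hvfr⟩ := Literature.Probability.Percolation.exists_mem_segment_frontier R.isOpen hkΩ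
      (fun hsub => hzΩ (hsub (right_mem_segment _ _ _)))
    have hzk' : z ∈ closedBall (Ψ w) r := mem_closedBall.2 hzk
    have hvk : dist v (Ψ w) ≤ r :=
      mem_closedBall.1 ((convex_closedBall _ _).segment_subset (mem_closedBall_self hr0) hzk' hvseg)
    have hvz : dist v z ≤ r :=
      mem_closedBall.1 ((convex_closedBall _ _).segment_subset
        (mem_closedBall.2 (by rw [dist_comm]; exact hzk)) (mem_closedBall_self hr0) hvseg)
    rw [← (R.iUnion_arc_holds : ⋃ k, R.arc k = frontier R.carrier), mem_iUnion] at hvfr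
    obtain ⟨j, hj⟩ := hvfr
    have hv13 : v ∉ A13 := fun h => by
      have := hM₁d _ hkMid v h
      rw [dist_comm] at this
      linarith
    fin_cases j
    · refine Or.inl (Or.inr (mem_sideCollar_of ⟨v, hj, by rw [dist_comm]; linarith⟩ fun i hi l hl => ?_))
      have key : min M₁ M₂ - r ≤ dist z l := by
        fin_cases i
        · exact absurd rfl hi
        · have := hM₁d _ hkMid l (Or.inl hl)
          linarith [dist_triangle (Ψ w) z l, dist_comm (Ψ w) z, min_le_left M₁ M₂]
        · have := hM₂d v hj l hl
          linarith [dist_triangle v z l, min_le_right M₁ M₂]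
        · have := hM₁d _ hkMid l (Or.inr hl)
          linarith [dist_triangle (Ψ w) z l, dist_comm (Ψ w) z, min_le_left M₁ M₂]
      have h4 : 4 * κ = min M₁ M₂ := by rw [hκdef]; ring
      linarith
    · exact absurd (Or.inl hj) hv13
    · refine Or.inr (mem_sideCollar_of ⟨v, hj, by rw [dist_comm]; linarith⟩ fun i hi l hl => ?_)
      have key : min M₁ M₂ - r ≤ dist z l := by
        fin_cases i
        · have := hM₂d l hl v hj
          linarith [dist_triangle v z l, dist_comm v l, min_le_right M₁ M₂]
        · have := hM₁d _ hkMid l (Or.inl hl)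
          linarith [dist_triangle (Ψ w) z l, dist_comm (Ψ w) z, min_le_left M₁ M₂]
        · exact absurd rfl hi
        · have := hM₁d _ hkMid l (Or.inr hl)
          linarith [dist_triangle (Ψ w) z l, dist_comm (Ψ w) z, min_le_left M₁ M₂]
      have h4 : 4 * κ = min M₁ M₂ := by rw [hκdef]; ring
      linarith
    · exact absurd (Or.inr hj) hv13
  -- points near the two outer sides lie in the collars, outside the domain
  have hout0 : ∀ k ∈ L₀, ∀ z : ℂ, dist z k ≤ r → z ∈ sideCollar R 0 κ \ R.carrier := by
    intro k hk z hzk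
    have hk' := hk
    obtain ⟨w, hw, rfl⟩ := hk
    rw [Complex.mem_reProdIm, mem_singleton_iff] at hw
    refine ⟨collar0 w ⟨le_of_eq hw.1.symm, by rw [hw.1]; linarith⟩ hw.2 z (by linarith), fun hzΩ => ?_⟩
    have := hg₀d _ hk' z (subset_closure hzΩ)
    rw [dist_comm] at this
    linarith
  have hout2 : ∀ k ∈ L₂, ∀ z : ℂ, dist z k ≤ r → z ∈ sideCollar R 2 κ \ R.carrier := by
    intro k hk z hzk
    have hk' := hk
    obtain ⟨w, hw, rfl⟩ := hk
    rw [Complex.mem_reProdIm, mem_singleton_iff] at hw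
    refine ⟨collar2 w ⟨by rw [hw.1]; linarith, le_of_eq hw.1⟩ hw.2 z (by linarith), fun hzΩ => ?_⟩
    have := hg₂d _ hk' z (subset_closure hzΩ)
    rw [dist_comm] at this
    linarith
  -- the lattice path
  have hS : ∀ p ∈ Literature.Probability.Percolation.edgePairs m ω K,
      p.1 ∈ {x : Site 2 | closedBall ((δ : ℂ) * squareLatticeEmbedding.z x) ρ ⊆ enlarge R κ} := by
    rintro p ⟨hadj, -, k, hkseg, hkK⟩
    show closedBall _ ρ ⊆ _
    intro z hz
    rw [mem_closedBall, hpt] at hz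
    have h1 := Literature.Probability.Percolation.dist_meshPoint_le_of_mem_segment hmpos hadj hkseg
    exact henl k (hKsub hkK) z (by linarith [dist_triangle z (meshPoint m p.1) k])
  obtain ⟨p₀, hp₀, hk₀seg⟩ := Literature.Probability.Percolation.exists_mem_edgePairs_of_mem hKO hk₀K
  obtain ⟨p₁, hp₁, hk₁seg⟩ := Literature.Probability.Percolation.exists_mem_edgePairs_of_mem hKO hk₁K
  have hconn := Literature.Probability.Percolation.openConnIn_of_isPreconnected_subset_openEdgeUnion hmpos hKc
    hKconn.isPreconnected hKO hS hp₀ hp₁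
  refine ⟨p₀.1, ?_, p₁.1, ?_, hconn⟩
  · show closedBall _ ρ ⊆ _
    intro z hz
    rw [mem_closedBall, hpt] at hz
    have h1 := Literature.Probability.Percolation.dist_meshPoint_le_of_mem_segment hmpos hp₀.1 hk₀seg
    exact hout0 k₀ hk₀ z (by linarith [dist_triangle z (meshPoint m p₀.1) k₀])
  · show closedBall _ ρ ⊆ _
    intro z hz
    rw [mem_closedBall, hpt] at hz
    have h1 := Literature.Probability.Percolation.dist_meshPoint_le_of_mem_segment hmpos hp₁.1 hk₁seg
    exact hout2 k₁ hk₁ z (by linarith [dist_triangle z (meshPoint m p₁.1) k₁])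

end Lower

end Freeze

/-- ANCHOR (registered sub-goal). THE LOWER INCLUSION OF THE BRIDGE: for a square model `Φ` of `R`, `0 < s ≤ 1/2` and
`η > 0` there are `0 < t ≤ η`, `κ > 0` and `r > 0` such that for meshes `δ` and thinning radii `ρ` with `δ√2 + ρ ≤ r`,
every Schramm–Smirnov crossing inside the drawn open edges (mesh `δ√2`) of the long thin chart quad
`Freeze.thinQuad (Freeze.tmodel Φ) t s` yields the thinned collar-to-collar crude event `Freeze.lowerCrossing R κ ρ δ`.
[folklore] -/
theorem thinQuad_crossing_subset_lowerCrossing : ∀ (R : ConformalRectangle) (Φ : ℂ ≃ₜ ℂ), Literature.Probability.Percolation.IsSquareModel R Φ → ∀ (s : ℝ), 0 < s → s ≤ 1 / 2 → ∀ (η : ℝ), 0 < η → ∃ t : ℝ, 0 < t ∧ t ≤ η ∧ ∃ κ : ℝ, 0 < κ ∧ ∃ r : ℝ, 0 < r ∧ ∀ (δ ρ : ℝ), 0 < δ → 0 ≤ ρ → δ * Real.sqrt 2 + ρ ≤ r → ∀ (ω : Literature.Probability.Percolation.BondConfig (Literature.Probability.LatticeModels.Site 2)) (K : Set ℂ), (Freeze.thinQuad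 (Freeze.tmodel Φ) t s).IsCrossing K → K ⊆ Literature.Probability.Percolation.openEdgeUnion (δ * Real.sqrt 2) ω → ω ∈ Freeze.lowerCrossing R κ ρ δ :=
  fun _ _ hΦ _ hs hs1 _ hη => Freeze.exists_lower_data hΦ hs hs1 hη

end Summit.CriticalPhenomena.CardyFormulaZ2.Theorems.CornerLineDescent.SymmetricSeed
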